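import Mathlib
import Literature.NumberTheory.Sieve.Maynard2016Lemma7Link
import Literature.NumberTheory.Sieve.Maynard2016QSystemClass
import Literature.NumberTheory.Sieve.MaynardSieveCounting2
import HarnessLib

/-!
# Maynard (2016), Lemma 7: the `q`-conditions of (6.27) as a linear system — one coprime class or empty

Trunk: AntSieve / parity (Maynard 2016 large-gaps ladder; named fact
`Literature.NumberTheory.Sieve.Maynard2016.Lemma7Tuple`).

J. Maynard, *Large gaps between primes*, Ann. of Math. 183 (2016) = arXiv:1408.5110, §6, proof of
Lemma 7, p. 12: after (6.27) (`Maynard2016Lemma7Link.sum_divSum_sub_sq_eq_sum_rbox`) the inner count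
is over `q ∈ Q` with, for every `j`, `[d_j,d'_j] ∣ p₀ + (h_j − h_i) q` and
`[e_j,e'_j] ∣ (m p₀ − 1) + m (h_j − h_i) q`; "the inner sum over `q` is empty unless … If all of these
conditions are satisfied, then the inner sum can be rewritten as a sum over … a single residue class
modulo the least common multiple … Moreover, this residue class will be coprime to the modulus."

PROVED here: the bridge from the natural-number conditions of (6.27) to a linear system over the
index type `Fin k ⊕ Fin k` (`sysD`, `sysP`, `sysA`, `system_iff_linearSystem`), the discharge of the
hypotheses of `Maynard2016QSystemClass.filter_eq_empty_or_eq_filter_mod` from the Lemma-7 data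
(squarefree coordinates, `d_j d'_j < p₀`, `(m p₀ − 1, e_j e'_j) = 1`, `(m p₀ − 1, h_j − h_i) = 1`:
`sys_squarefree`, `sys_unit`, `sys_constant_coprime`), and the conclusion
`filter_system_eq_empty_or_class`: the `q`-set of (6.27) inside any `Q ⊆ {q ≥ 1 : h_i q < p₀}` is
empty or equals `{q ∈ Q : q ≡ c (mod r)}` for one class `c` coprime to the radical modulus
`r = rad(∏_j [d_j,d'_j] [e_j,e'_j])`; `support_hyps_of_lam_ne_zero` /
`filter_system_eq_empty_or_class_of_lam_ne_zero` derive those tuple hypotheses on the support of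
`λ_{d,e} λ_{d',e'}` (`Maynard2016LamSupport`, `squarefree_of_lam_ne_zero`), leaving only
`(m p₀ − 1, h_j − h_i) = 1` (true for large `x`, all prime factors of `h_j − h_i` being `≤ y`).

## References

* J. Maynard, *Large gaps between primes*, Ann. of Math. (2) 183 (2016), 915–933; arXiv:1408.5110,
  §6, proof of Lemma 7, p. 12. [Maynard2016LargeGaps]
-/

open Finset
open scoped BigOperators

namespace Literature.NumberTheory.Sieve

namespace Maynard2016

variable {k : ℕ}

/-- The moduli of the `q`-system: `[d_j,d'_j]` on the `d`-side, `[e_j,e'_j]` on the `e`-side.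
[cite: Maynard2016LargeGaps, Lemma 7 (proof, p. 12)] -/
def sysD (d d' e e' : Fin k → ℕ) : Fin k ⊕ Fin k → ℕ :=
  Sum.elim (fun j => Nat.lcm (d j) (d' j)) (fun j => Nat.lcm (e j) (e' j))

/-- The constant terms: `p₀` on the `d`-side, `m p₀ − 1` on the `e`-side. [cite: Maynard2016LargeGaps, Lemma 7 (proof, p. 12)] -/
def sysP (k : ℕ) (m p₀ : ℕ) : Fin k ⊕ Fin k → ℤ :=
  Sum.elim (fun _ => (p₀ : ℤ)) (fun _ => (m : ℤ) * p₀ - 1)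

/-- The coefficients of `q`: `h_j − h_i` on the `d`-side, `m (h_j − h_i)` on the `e`-side.
[cite: Maynard2016LargeGaps, Lemma 7 (proof, p. 12)] -/
noncomputable def sysA (k x : ℕ) (i : Fin k) (m : ℕ) : Fin k ⊕ Fin k → ℤ :=
  Sum.elim (fun j => (hTuple k x j : ℤ) - hTuple k x i)
    (fun j => (m : ℤ) * ((hTuple k x j : ℤ) - hTuple k x i))

/-- Unfolding `sysD` on the `d`-side. [folklore] -/
@[simp] private theorem sysD_inl (d d' e e' : Fin k → ℕ) (j : Fin k) :
    sysD d d' e e' (Sum.inl j) = Nat.lcm (d j) (d' j) := rfl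
/-- Unfolding `sysD` on the `e`-side. [folklore] -/
@[simp] private theorem sysD_inr (d d' e e' : Fin k → ℕ) (j : Fin k) :
    sysD d d' e e' (Sum.inr j) = Nat.lcm (e j) (e' j) := rfl
/-- Unfolding `sysP` on the `d`-side. [folklore] -/
@[simp] private theorem sysP_inl (k m p₀ : ℕ) (j : Fin k) : sysP k m p₀ (Sum.inl j) = (p₀ : ℤ) := rfl
/-- Unfolding `sysP` on the `e`-side. [folklore] -/
@[simp] private theorem sysP_inr (k m p₀ : ℕ) (j : Fin k) :
    sysP k m p₀ (Sum.inr j) = (m : ℤ) * p₀ - 1 := rfl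
/-- Unfolding `sysA` on the `d`-side. [folklore] -/
@[simp] private theorem sysA_inl (k x : ℕ) (i : Fin k) (m : ℕ) (j : Fin k) :
    sysA k x i m (Sum.inl j) = (hTuple k x j : ℤ) - hTuple k x i := rfl
/-- Unfolding `sysA` on the `e`-side. [folklore] -/
@[simp] private theorem sysA_inr (k x : ℕ) (i : Fin k) (m : ℕ) (j : Fin k) :
    sysA k x i m (Sum.inr j) = (m : ℤ) * ((hTuple k x j : ℤ) - hTuple k x i) := rfl

/-- The product of the moduli splits into the two sides. [cite: Maynard2016LargeGaps, Lemma 7 (proof, p. 12)] -/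
theorem prod_sysD (d d' e e' : Fin k → ℕ) :
    ∏ t, sysD d d' e e' t = (∏ j, Nat.lcm (d j) (d' j)) * ∏ j, Nat.lcm (e j) (e' j) := by
  rw [Fintype.prod_sum_type]
  rfl

/-! ### The bridge from (6.27) -/

/-- **The conditions of (6.27) are the linear system** `sysD_t ∣ sysP_t + sysA_t q` (for `h_i q < p₀`,
`m ≥ 1`). [cite: Maynard2016LargeGaps, Lemma 7 (proof, p. 12)] -/
theorem system_iff_linearSystem {x m p₀ : ℕ} (hm : 1 ≤ m) {i : Fin k} (d d' e e' : Fin k → ℕ)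
    {q : ℕ} (hlt : hTuple k x i * q < p₀) :
    (∀ j ∈ (Finset.univ : Finset (Fin k)),
        Nat.lcm (d j) (d' j) ∣ p₀ - hTuple k x i * q + hTuple k x j * q ∧
          Nat.lcm (e j) (e' j) ∣ m * (p₀ - hTuple k x i * q + hTuple k x j * q) - 1) ↔
      ∀ t ∈ (Finset.univ : Finset (Fin k ⊕ Fin k)),
        (sysD d d' e e' t : ℤ) ∣ sysP k m p₀ t + sysA k x i m t * q := by
  have hle : hTuple k x i * q ≤ p₀ := hlt.le
  -- the two casts
  have hcast1 : ∀ j : Fin k, ((p₀ - hTuple k x i * q + hTuple k x j * q : ℕ) : ℤ) =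
      (p₀ : ℤ) + ((hTuple k x j : ℤ) - hTuple k x i) * q := fun j => cast_sub_add_hTuple_mul j hle
  have hcast2 : ∀ j : Fin k, ((m * (p₀ - hTuple k x i * q + hTuple k x j * q) - 1 : ℕ) : ℤ) =
      ((m : ℤ) * p₀ - 1) + (m : ℤ) * ((hTuple k x j : ℤ) - hTuple k x i) * q := by
    intro j
    have h1 : 1 ≤ m * (p₀ - hTuple k x i * q + hTuple k x j * q) :=
      Nat.one_le_iff_ne_zero.2 (Nat.mul_ne_zero (by omega) (by omega))
    push_cast [Nat.cast_sub h1, Nat.cast_sub hle]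
    ring
  constructor
  · intro h t _
    rcases t with j | j
    · simp only [sysD_inl, sysP_inl, sysA_inl]
      rw [← hcast1 j]
      exact Int.natCast_dvd_natCast.2 (h j (Finset.mem_univ j)).1
    · simp only [sysD_inr, sysP_inr, sysA_inr]
      rw [← hcast2 j]
      exact Int.natCast_dvd_natCast.2 (h j (Finset.mem_univ j)).2
  · intro h j _
    constructor
    · have := h (Sum.inl j) (Finset.mem_univ _)
      simp only [sysD_inl, sysP_inl, sysA_inl] at this
      rw [← hcast1 j] at this
      exact Int.natCast_dvd_natCast.1 this
    · have := h (Sum.inr j) (Finset.mem_univ _)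
      simp only [sysD_inr, sysP_inr, sysA_inr] at this
      rw [← hcast2 j] at this
      exact Int.natCast_dvd_natCast.1 this

/-! ### Discharging the hypotheses of the class dichotomy -/

/-- Squarefree coordinates give squarefree moduli. [cite: Maynard2016LargeGaps, Lemma 7 (proof, p. 12)] -/
theorem sys_squarefree {d d' e e' : Fin k → ℕ} (hd : ∀ j, Squarefree (d j)) (hd' : ∀ j, Squarefree (d' j))
    (he : ∀ j, Squarefree (e j)) (he' : ∀ j, Squarefree (e' j)) :
    ∀ t ∈ (Finset.univ : Finset (Fin k ⊕ Fin k)), Squarefree (sysD d d' e e' t) := by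
  rintro (j | j) -
  · exact MaynardSieve.squarefree_lcm (hd j) (hd' j)
  · exact MaynardSieve.squarefree_lcm (he j) (he' j)

/-- `m p₀ − 1` is coprime to `m`. [folklore] -/
private theorem isCoprime_mul_sub_one (m p₀ : ℤ) : IsCoprime (m * p₀ - 1) m :=
  ⟨-1, p₀, by ring⟩

/-- **Unit coefficients** whenever a condition is solvable: on the `d`-side because `p₀` is a prime
exceeding `d_j d'_j`, on the `e`-side because `(m p₀ − 1, m (h_j − h_i)) = 1`.
[cite: Maynard2016LargeGaps, Lemma 7 (proof, p. 12)] -/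
theorem sys_unit {x m p₀ : ℕ} (hp₀ : p₀.Prime) {i : Fin k} {d d' e e' : Fin k → ℕ}
    (hd0 : ∀ j, d j ≠ 0) (hd0' : ∀ j, d' j ≠ 0) (hdlt : ∀ j, d j * d' j < p₀)
    (hei : e i = 1) (hei' : e' i = 1)
    (hacop : ∀ j, j ≠ i → IsCoprime ((m : ℤ) * p₀ - 1) ((hTuple k x j : ℤ) - hTuple k x i)) :
    ∀ t ∈ (Finset.univ : Finset (Fin k ⊕ Fin k)), ∀ q : ℕ,
      (sysD d d' e e' t : ℤ) ∣ sysP k m p₀ t + sysA k x i m t * q →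
        IsCoprime (sysA k x i m t) (sysD d d' e e' t : ℤ) := by
  rintro (j | j) - q h
  · simp only [sysD_inl, sysP_inl, sysA_inl] at h ⊢
    have hpos : 0 < Nat.lcm (d j) (d' j) := Nat.pos_of_ne_zero (Nat.lcm_ne_zero (hd0 j) (hd0' j))
    have hlt : Nat.lcm (d j) (d' j) < p₀ :=
      lt_of_le_of_lt (Nat.le_of_dvd (Nat.pos_of_ne_zero (Nat.mul_ne_zero (hd0 j) (hd0' j)))
        (Nat.lcm_dvd_mul _ _)) (hdlt j)
    exact isCoprime_of_intDvd_linear_prime hp₀ hpos hlt h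
  · simp only [sysD_inr, sysP_inr, sysA_inr] at h ⊢
    by_cases hj : j = i
    · -- the `i`-th `e`-condition has modulus `[e_i, e'_i] = 1`
      subst hj
      rw [hei, hei', Nat.lcm_one_left, Nat.cast_one]
      exact isCoprime_one_right
    · exact isCoprime_of_intDvd_linear_of_isCoprime
        ((isCoprime_mul_sub_one (m : ℤ) p₀).mul_right (hacop j hj)) h

/-- **No prime of a modulus divides its constant term**: `p ∣ [d_j,d'_j] ⇒ p < p₀`, and
`p ∣ [e_j,e'_j] ⇒ p ∤ m p₀ − 1` (from `(m p₀ − 1, e_j e'_j) = 1`).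
[cite: Maynard2016LargeGaps, Lemma 7 (proof, p. 12)] -/
theorem sys_constant_coprime {m p₀ : ℕ} (hp₀ : p₀.Prime) (hm : 1 ≤ m)
    {d d' e e' : Fin k → ℕ} (hd0 : ∀ j, d j ≠ 0) (hd0' : ∀ j, d' j ≠ 0)
    (hdlt : ∀ j, d j * d' j < p₀) (hecop : ∀ j, Nat.Coprime (m * p₀ - 1) (e j * e' j)) :
    ∀ t ∈ (Finset.univ : Finset (Fin k ⊕ Fin k)), ∀ p : ℕ, p.Prime → p ∣ sysD d d' e e' t →
      ¬ (p : ℤ) ∣ sysP k m p₀ t := by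
  rintro (j | j) - p hp hpD hpP
  · simp only [sysD_inl, sysP_inl] at hpD hpP
    have hpp₀ : p ∣ p₀ := Int.natCast_dvd_natCast.1 hpP
    have hple : p ≤ d j * d' j :=
      Nat.le_of_dvd (Nat.pos_of_ne_zero (Nat.mul_ne_zero (hd0 j) (hd0' j)))
        (hpD.trans (Nat.lcm_dvd_mul _ _))
    rcases (Nat.dvd_prime hp₀).1 hpp₀ with h1 | h1
    · exact hp.one_lt.ne' h1
    · have := hdlt j; omega
  · simp only [sysD_inr, sysP_inr] at hpD hpP
    have h1 : 1 ≤ m * p₀ := Nat.one_le_iff_ne_zero.2 (Nat.mul_ne_zero (by omega) hp₀.ne_zero)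
    have hcast : ((m * p₀ - 1 : ℕ) : ℤ) = (m : ℤ) * p₀ - 1 := by push_cast [Nat.cast_sub h1]; ring
    rw [← hcast, Int.natCast_dvd_natCast] at hpP
    have hpe : p ∣ e j * e' j := hpD.trans (Nat.lcm_dvd_mul _ _)
    have h1 : Nat.Coprime p p :=
      Nat.Coprime.coprime_dvd_right hpe (Nat.Coprime.coprime_dvd_left hpP (hecop j))
    exact hp.one_lt.ne' ((Nat.coprime_self p).1 h1)

/-! ### The conclusion -/

/-- **The `q`-set of (6.27) is empty or one coprime class.**  For `p₀` prime, `m ≥ 1`, a tuple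
`(d, d', e, e')` with squarefree coordinates, `d_j d'_j < p₀`, `(m p₀ − 1, e_j e'_j) = 1`,
`e_i = e'_i = 1` (the restriction of (6.26)) and `(m p₀ − 1, h_j − h_i) = 1` for `j ≠ i`, and any finite
`Q` with `h_i q < p₀` on it: the set of
`q ∈ Q` satisfying the divisibility conditions of (6.27) is either empty, or equal to
`{q ∈ Q : q ≡ c (mod r)}` for one class `c` coprime to `r = rad(∏_j [d_j,d'_j][e_j,e'_j])`.
[cite: Maynard2016LargeGaps, Lemma 7 (proof, p. 12)] -/
theorem filter_system_eq_empty_or_class {x m p₀ : ℕ} (hp₀ : p₀.Prime) (hm : 1 ≤ m) {i : Fin k}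
    {d d' e e' : Fin k → ℕ} (hd : ∀ j, Squarefree (d j)) (hd' : ∀ j, Squarefree (d' j))
    (he : ∀ j, Squarefree (e j)) (he' : ∀ j, Squarefree (e' j)) (hdlt : ∀ j, d j * d' j < p₀)
    (hecop : ∀ j, Nat.Coprime (m * p₀ - 1) (e j * e' j)) (hei : e i = 1) (hei' : e' i = 1)
    (hacop : ∀ j, j ≠ i → IsCoprime ((m : ℤ) * p₀ - 1) ((hTuple k x j : ℤ) - hTuple k x i))
    (Q : Finset ℕ) (hQ : ∀ q ∈ Q, hTuple k x i * q < p₀) :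
    Q.filter (fun q => ∀ j ∈ (Finset.univ : Finset (Fin k)),
        Nat.lcm (d j) (d' j) ∣ p₀ - hTuple k x i * q + hTuple k x j * q ∧
          Nat.lcm (e j) (e' j) ∣ m * (p₀ - hTuple k x i * q + hTuple k x j * q) - 1) = ∅ ∨
      ∃ c, c < ∏ p ∈ (∏ t, sysD d d' e e' t).primeFactors, p ∧
        c.Coprime (∏ p ∈ (∏ t, sysD d d' e e' t).primeFactors, p) ∧
        Q.filter (fun q => ∀ j ∈ (Finset.univ : Finset (Fin k)),
            Nat.lcm (d j) (d' j) ∣ p₀ - hTuple k x i * q + hTuple k x j * q ∧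
              Nat.lcm (e j) (e' j) ∣ m * (p₀ - hTuple k x i * q + hTuple k x j * q) - 1) =
          Q.filter (fun q : ℕ => q % (∏ p ∈ (∏ t, sysD d d' e e' t).primeFactors, p) =
            c % (∏ p ∈ (∏ t, sysD d d' e e' t).primeFactors, p)) := by
  classical
  have hd0 : ∀ j, d j ≠ 0 := fun j => (hd j).ne_zero
  have hd0' : ∀ j, d' j ≠ 0 := fun j => (hd' j).ne_zero
  -- replace the (6.27) predicate by the linear system on `Q`
  have hfilt : Q.filter (fun q => ∀ j ∈ (Finset.univ : Finset (Fin k)),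
        Nat.lcm (d j) (d' j) ∣ p₀ - hTuple k x i * q + hTuple k x j * q ∧
          Nat.lcm (e j) (e' j) ∣ m * (p₀ - hTuple k x i * q + hTuple k x j * q) - 1) =
      Q.filter (fun q : ℕ => ∀ t ∈ (Finset.univ : Finset (Fin k ⊕ Fin k)),
        (sysD d d' e e' t : ℤ) ∣ sysP k m p₀ t + sysA k x i m t * (q : ℤ)) :=
    Finset.filter_congr fun q hq => system_iff_linearSystem hm d d' e e' (hQ q hq)
  rw [hfilt]
  have h := filter_eq_empty_or_eq_filter_mod (Finset.univ : Finset (Fin k ⊕ Fin k))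
    (sysD d d' e e') (sysP k m p₀) (sysA k x i m) (sys_squarefree hd hd' he he')
    (sys_unit hp₀ hd0 hd0' hdlt hei hei' hacop) (sys_constant_coprime hp₀ hm hd0 hd0' hdlt hecop) Q
  simpa using h

/-! ### The hypotheses from the support of `λ` -/

/-- Coordinates of a box element are `≥ 1` and `≤ X`. [folklore] -/
private theorem one_le_of_mem_box {X : ℕ} {d : Fin k → ℕ} (hd : d ∈ box k X) (ℓ : Fin k) :
    1 ≤ d ℓ ∧ d ℓ ≤ X := by
  have h := Fintype.mem_piFinset.1 hd ℓ
  exact Finset.mem_Icc.1 h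

/-- A number all of whose prime factors are `≤ Y` — in particular any `1 ≤ a ≤ Y` — is coprime to an
`N` with `(N, P_Y) = 1`. [cite: Maynard2016LargeGaps, Lemma 7 (proof, display (6.26))] -/
theorem coprime_of_le_of_coprime_primorial {N a : ℕ} {Y : ℝ} (hN : Nat.Coprime N (primorial ⌊Y⌋₊))
    (ha0 : a ≠ 0) (ha : (a : ℝ) ≤ Y) : Nat.Coprime N a := by
  refine Nat.coprime_of_dvd fun p hp hpN hpa => ?_
  have hpY : p ∣ primorial ⌊Y⌋₊ := by
    rw [hp.dvd_primorial_iff]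
    have h1 : p ≤ a := Nat.le_of_dvd (Nat.pos_of_ne_zero ha0) hpa
    exact Nat.le_floor (le_trans (by exact_mod_cast h1) ha)
  have h3 : p ∣ Nat.gcd N (primorial ⌊Y⌋₊) := Nat.dvd_gcd hpN hpY
  rw [hN] at h3
  exact hp.one_lt.ne' (Nat.dvd_one.1 h3)

/-- **On the support of `λ_{d,e} λ_{d',e'}`** the size/coprimality hypotheses of
`filter_system_eq_empty_or_class` hold: squarefree coordinates, `d_j d'_j ≤ x^{1/5} ≤ x < p₀`
(support of `F`), `(m p₀ − 1, e_j e'_j) = 1` (`e_j, e'_j ≤ y` and `(m p₀ − 1, P_y) = 1`).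
[cite: Maynard2016LargeGaps, Lemma 7 (proof, p. 12)] -/
theorem support_hyps_of_lam_ne_zero {J : ℕ} {c : Fin J → ℝ} {Fd : Fin k → Fin J → ℝ → ℝ}
    {G : ℝ → ℝ} (hD : IsSieveData k J c Fd G) {ε : ℝ} {x : ℕ} (hx1 : 1 ≤ x)
    (hlogx : 0 < Real.log x) (hlogy : 0 < Real.log (y ε x)) {m p₀ : ℕ} (hxp : x < p₀)
    (hcop : Nat.Coprime (m * p₀ - 1) (primorial ⌊y ε x⌋₊)) {d d' e e' : Fin k → ℕ}
    (hdb : d ∈ box k x) (hdb' : d' ∈ box k x) (heb : e ∈ box k x) (heb' : e' ∈ box k x)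
    (hl : lam c Fd G ε x d e ≠ 0) (hl' : lam c Fd G ε x d' e' ≠ 0) :
    (∀ j, Squarefree (d j)) ∧ (∀ j, Squarefree (d' j)) ∧ (∀ j, Squarefree (e j)) ∧
      (∀ j, Squarefree (e' j)) ∧ (∀ j, d j * d' j < p₀) ∧
      (∀ j, Nat.Coprime (m * p₀ - 1) (e j * e' j)) := by
  have hx0 : (0 : ℝ) < x := by exact_mod_cast (show 0 < x by omega)
  have hx1' : (1 : ℝ) ≤ x := by exact_mod_cast hx1
  -- `d_j ≤ x^{1/10}` on the support
  have hdle : ∀ {d e : Fin k → ℕ}, d ∈ box k x → lam c Fd G ε x d e ≠ 0 →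
      ∀ j, (d j : ℝ) ≤ (x : ℝ) ^ (1 / 10 : ℝ) := by
    intro d e hdb hl j
    by_contra hlt
    push Not at hlt
    exact hl (lam_eq_zero_of_rpow_lt hD hlogx (fun ℓ => (one_le_of_mem_box hdb ℓ).1) hlt)
  -- `e_j ≤ y` on the support
  have hele : ∀ {d e : Fin k → ℕ}, lam c Fd G ε x d e ≠ 0 → ∀ j, (e j : ℝ) ≤ y ε x := by
    intro d e hl j
    by_contra hlt
    push Not at hlt
    exact hl (lam_eq_zero_of_y_lt hD hlogy hlt)
  refine ⟨fun j => (squarefree_of_lam_ne_zero hl j).1, fun j => (squarefree_of_lam_ne_zero hl' j).1,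
    fun j => (squarefree_of_lam_ne_zero hl j).2, fun j => (squarefree_of_lam_ne_zero hl' j).2,
    fun j => ?_, fun j => ?_⟩
  · -- `d_j d'_j ≤ x^{1/10} x^{1/10} = x^{1/5} ≤ x < p₀`
    have h1 := hdle hdb hl j
    have h2 := hdle hdb' hl' j
    have h3 : ((d j * d' j : ℕ) : ℝ) ≤ (x : ℝ) ^ (1 / 10 : ℝ) * (x : ℝ) ^ (1 / 10 : ℝ) := by
      push_cast
      exact mul_le_mul h1 h2 (Nat.cast_nonneg _) (Real.rpow_nonneg hx0.le _)
    have h4 : (x : ℝ) ^ (1 / 10 : ℝ) * (x : ℝ) ^ (1 / 10 : ℝ) ≤ x := by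
      rw [← Real.rpow_add hx0]
      calc (x : ℝ) ^ (1 / 10 + 1 / 10 : ℝ) ≤ (x : ℝ) ^ (1 : ℝ) :=
            Real.rpow_le_rpow_of_exponent_le hx1' (by norm_num)
        _ = x := Real.rpow_one _
    have h5 : ((d j * d' j : ℕ) : ℝ) < p₀ := lt_of_le_of_lt (h3.trans h4) (by exact_mod_cast hxp)
    exact_mod_cast h5
  · have he1 := one_le_of_mem_box heb j
    have he1' := one_le_of_mem_box heb' j
    exact Nat.Coprime.mul_right
      (coprime_of_le_of_coprime_primorial hcop (by omega) (hele hl j))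
      (coprime_of_le_of_coprime_primorial hcop (by omega) (hele hl' j))

/-- **(6.27) ⇒ one coprime class or nothing, on the support of `λλ'`.**  The form consumed by the
successor: for `p₀ > x` prime with `(m p₀ − 1, P_y) = 1`, `m ≥ 1`, `(m p₀ − 1, h_j − h_i) = 1`
(`j ≠ i`; true for large `x`), `d, d' ∈ box`, `e, e' ∈ rbox` (`e_i = e'_i = 1`) with
`λ_{d,e} λ_{d',e'} ≠ 0`, and `Q ⊆ {q : h_i q < p₀}`.
[cite: Maynard2016LargeGaps, Lemma 7 (proof, p. 12)] -/
theorem filter_system_eq_empty_or_class_of_lam_ne_zero {J : ℕ} {c : Fin J → ℝ}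
    {Fd : Fin k → Fin J → ℝ → ℝ} {G : ℝ → ℝ} (hD : IsSieveData k J c Fd G) {ε : ℝ} {x : ℕ}
    (hx1 : 1 ≤ x) (hlogx : 0 < Real.log x) (hlogy : 0 < Real.log (y ε x)) {m p₀ : ℕ} (hm : 1 ≤ m)
    (hp₀ : p₀.Prime) (hxp : x < p₀) (hcop : Nat.Coprime (m * p₀ - 1) (primorial ⌊y ε x⌋₊))
    {i : Fin k}
    (hacop : ∀ j, j ≠ i → IsCoprime ((m : ℤ) * p₀ - 1) ((hTuple k x j : ℤ) - hTuple k x i))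
    {d d' e e' : Fin k → ℕ} (hdb : d ∈ box k x) (hdb' : d' ∈ box k x) (her : e ∈ rbox k x i)
    (her' : e' ∈ rbox k x i) (hl : lam c Fd G ε x d e ≠ 0) (hl' : lam c Fd G ε x d' e' ≠ 0)
    (Q : Finset ℕ) (hQ : ∀ q ∈ Q, hTuple k x i * q < p₀) :
    Q.filter (fun q => ∀ j ∈ (Finset.univ : Finset (Fin k)),
        Nat.lcm (d j) (d' j) ∣ p₀ - hTuple k x i * q + hTuple k x j * q ∧
          Nat.lcm (e j) (e' j) ∣ m * (p₀ - hTuple k x i * q + hTuple k x j * q) - 1) = ∅ ∨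
      ∃ c, c < ∏ p ∈ (∏ t, sysD d d' e e' t).primeFactors, p ∧
        c.Coprime (∏ p ∈ (∏ t, sysD d d' e e' t).primeFactors, p) ∧
        Q.filter (fun q => ∀ j ∈ (Finset.univ : Finset (Fin k)),
            Nat.lcm (d j) (d' j) ∣ p₀ - hTuple k x i * q + hTuple k x j * q ∧
              Nat.lcm (e j) (e' j) ∣ m * (p₀ - hTuple k x i * q + hTuple k x j * q) - 1) =
          Q.filter (fun q : ℕ => q % (∏ p ∈ (∏ t, sysD d d' e e' t).primeFactors, p) =
            c % (∏ p ∈ (∏ t, sysD d d' e e' t).primeFactors, p)) := by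
  obtain ⟨heb, hei⟩ := mem_rbox.1 her
  obtain ⟨heb', hei'⟩ := mem_rbox.1 her'
  obtain ⟨hd, hd', he, he', hdlt, hecop⟩ :=
    support_hyps_of_lam_ne_zero hD hx1 hlogx hlogy hxp hcop hdb hdb' heb heb' hl hl'
  exact filter_system_eq_empty_or_class hp₀ hm hd hd' he he' hdlt hecop hei hei' hacop Q hQ

end Maynard2016

end Literature.NumberTheory.Sieve
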